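import Summits.AtomisticToContinuum.BoseEinsteinCondensation.Theorems.HardCoreExtension.Negative.UniformRepairNormalForm
import Summits.AtomisticToContinuum.BoseEinsteinCondensation.Theses.BECHardSphereReduction
import Summits.AtomisticToContinuum.BoseEinsteinCondensation.Theorems.BECConjugateDominationHardCoreExtensionSmoothDominant
import Summits.AtomisticToContinuum.BoseEinsteinCondensation.Theorems.BECConjugateDominationHardCoreExtensionDominationResidue

/-!
# Route `BECConjugateDomination`, crux `HardCoreExtension` (stmt-AtomisticToContinuum-11786),
# line `domination-order-reversal` — skeleton v1.4 (lead c8, 2026-08-17: the planner's CHECKED SKELETON of round 1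
# with the registered stubs restated in tree vocabulary; stub 2 `stub_smoothDominant` LANDED p133478 and imported;
# composition = the LANDED node `hardCoreExtension_of_dominationResidue` (p133712); 3 sorries = stubs 1, 3, 4)

Crux (by name, concluded by `HardCoreExtension_of` below — the unique such theorem of this file):
`BECConjugateDomination.HardCoreExtension = A → B`, `A` = ground-state BEC at all small densities for
every potential of the SMOOTH CLASS (`InSmoothClass`: repulsive finite range, finite, `C²` as
`x ↦ v(|x|)`, edge condition `‖D²ṽ‖ ≤ Cₑ√ṽ`), `B` = the conjunct (the same for EVERY repulsive
finite-range `v : ℝ → ℝ≥0∞`, hard cores, shells, kinks included).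

Idea (card `Ideas/domination-order-reversal.md`, triage r1-1/2/3: pass ×3): DOMINATE, DON'T APPROXIMATE.
No sequence `vₙ ↑ v` and no limit (the recorded reason the crux is XL: `A`'s constants `ρ₀(vₙ), c(vₙ)`
escape); instead ONE comparison potential above the target in an ORDER that the condensate number
reverses up to `o(N)`, eventually in `N`, at every small density (`CondensateBelow w v`:
`cn(w; N, L_N(ρ)) ≤ cn(v; N, L_N(ρ)) + εN`), so that `A` is invoked once, at one smooth `w`, and an
additive `o(N)` against the FIXED `c(w, ρ) > 0` is harmless (`diluteBEC_of_condensateBelow'`).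
The conjunct's class splits DEFINITIONALLY (`bounded_or_rough`) into

* (b) potentials BOUNDED on `[0, ∞)` — steps, finite shells, kinks, `C²` profiles violating the edge
  condition, non-lsc profiles `V₀·1_K` —: `stub_smoothDominant` puts a smooth-class `w` pointwise
  above `v`, and `stub_dominationOrderReversal` (the card's first lemma = Disproof open target (T1)
  WITH slack, ANTITONE direction; pointwise calibration) reverses the order;
* (h) ROUGH cores (unbounded on `[0, ∞)`: hard cores `⊤·1_{[0,a]}`, hard core + tail, hard sets,
  `r⁻ᵖ` cores): no finite potential dominates them pointwise, but the hard sphere `HS_a = ⊤·1_{(-∞,a]}`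
  of any radius `a >` range does; `stub_hardCoreDomination` ((T1) with slack, hard-core dominant:
  "hard spheres are the worst condensers among rough potentials of shorter range") gives
  `cn(HS_a) ≤ cn(v) + o(N)`, and `stub_hardSphereStandIn` — the card's RECALIBRATION of the order
  (scattering-length calibration `𝔞(w) ≥ 2a`: depletion `1.5045√(ρ𝔞³)N` is increasing in `𝔞`) in its
  weakest sufficient form — supplies ONE smooth-class `w` per radius with `cn(w) ≤ cn(HS_a) + o(N)`.
  Transitivity + `A` at that `w` finish.

Composition (kernel-checked, no `sorry` of its own): `hardCoreExtension_of_parts :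
Sig.stub_dominationOrderReversal → Sig.stub_smoothDominant → Sig.stub_hardCoreDomination →
Sig.stub_hardSphereStandIn → (A bundled) → ∀ v admissible, DiluteBEC v` (pure glue, unfolded form) and
`HardCoreExtension_of : BECConjugateDomination.HardCoreExtension` — the crux BY NAME from the four
registered `stub_*` (the unique theorem of this file concluding the crux decl). Cross-links (sorry-free): `hardCoreDomination_of_hardCoreDominates` (the open rank-2 crux
`BECHardSphereReduction.HardCoreDominates`, stmt-11884, fixed-box exact form, IMPLIES stub 3);
`hardSphereBEC_of_standIn'` (stub 4 + `A` give `BECHardSphereReduction.HardSphereBEC`, stmt-11885);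
`roughHalf_of_hardSphereBEC` (stub 3 + stmt-11885 give the rough half WITHOUT `A`);
`boundedHalf_of` (stubs 1–2 give the card's `HardCoreExtensionBounded` from `A` verbatim — the line's
first deliverable, triage r1-1 sharpening).

Disproof.lean (gen 2) honoured: every comparison carries `∃ ρ₁` AFTER the potentials, `∀ᶠ N` and an
additive `εN` (§3/§4 `not_condensateNumber_mono_potential`, `not_hasGroundStateBEC_mono_potential` —
the ISOTONE / unguarded forms are refuted; landed `Negative/HighDensityObstruction`: hard spheres above
`8/a³` have `cn = 0`, so a density-uniform comparison would be false; landed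
`Negative/ScalingReductions` §C: no `ρ₁` uniform over a scale-free class anywhere here); the line never
transfers BEC UP the pointwise order (`monotoneDiluteTransfer_iff_conjunct`); (T1) with slack is the
disprover's own open target ("no counterexample in 2-body box models", §9); §7's fixed-box degeneracy
junk does not bite thermodynamic statements with a dilute guard (§8: `DominationOrderReversal`
"CONSISTENT, NOT REFUTABLE HERE"). No `_false_without_` theorem is registered for this crux (gen 2).

Conventions: statements of the registered stubs are the `Prop`s `Sig.stub_<name>` (the device of
`Lines/conditional-law-poincare.lean`: a lead's reshape may take them as hypotheses BY NAME and still
pass the layer-invariant audit); the registered obligations are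
`theorem stub_<name> : Sig.stub_<name> := by sorry`. Hard spheres are
written `Set.indicator (Set.Iic a) (fun _ => ⊤)` (`hardSphere a`), VERBATIM the spelling of route
`BECHardSphereReduction` (items 11884/11885), so that those items plug in by name; it differs from the
tree's `hardCorePotential a` (`⊤` on `r < a`) only at the null radius `r = a` and at `r < 0`.

References: LSSY2005 §1.2, Ch. 2 (after (2.1)), Ch. 5, App. C; Dyson1957; LeeHuangYang (depletion
`(8/3√π)√(ρa³)`, via LSSY2005 (5.x)/BoccatoEtAl2019Acta Thm 1.1 in the GP regime);
GiorginiBoronatCasulleras1999 (DMC: hard vs soft spheres, universality in `ρa³`); RossiSalasnich2013;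
FournaisSolovej2020; card audit AUDIT-37-g3 of summit card repulsion-monotone-hard-sphere (no
comparison theorem for `λ_max(γ)` in `v` in print).
-/

noncomputable section

namespace Summit.AtomisticToContinuum.BoseEinsteinCondensation.Cruxes.HardCoreExtension.DominationOrderReversal

open Literature.MathematicalPhysics.QuantumManyBody.BoseGas
open _root_.Filter _root_.MeasureTheory
open scoped ENNReal NNReal Topology
open Summit.AtomisticToContinuum.BoseEinsteinCondensation.Theses

/-! ## Vocabulary of the line (the class, two predicates, one potential family) -/

/-- The SMOOTH CLASS of the route — the four curried hypotheses of the crux's antecedent on a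
potential, bundled: repulsive finite range, finite, `C²` as `x ↦ v(|x|)` on `ℝ³`, edge condition
`‖D²ṽ‖ ≤ Cₑ√ṽ`. VERBATIM the body of `FisherGaussianDensityMode.InSmoothClass`
(`Theorems/BECConjugateDominationDefs.lean`) and of `Disproof.SmoothClass`; restated (not imported)
only because that Defs module is being edited concurrently (farm-incoherent at writing time).
[cite: LSSY2005, §1.2 (1.16) and Ch. 2 (2.1)] -/
def InSmoothClass (v : ℝ → ℝ≥0∞) : Prop :=
  IsRepulsiveFiniteRange v ∧ (∀ r, v r ≠ ⊤) ∧ ContDiff ℝ 2 (fun x : Space => (v ‖x‖).toReal) ∧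
    ∃ Cₑ : ℝ, ∀ x : Space,
      ‖iteratedFDeriv ℝ 2 (fun x : Space => (v ‖x‖).toReal) x‖ ≤ Cₑ * Real.sqrt ((v ‖x‖).toReal)

/-- **Order reversal in condensation** (`w ≼ v`): at every sufficiently small density, along the
thermodynamic sequence `L_N = (N/ρ)^{1/3}`, the condensate number of `w` exceeds that of `v` by at
most `εN`, eventually in `N`, for every `ε > 0` — i.e. `limsup_N (cn w − cn v)/N ≤ 0` at each fixed
small `ρ`. The density threshold comes AFTER the pair `(w, v)` (Disproof §3/§6: necessary). [folklore] -/
def CondensateBelow (w v : ℝ → ℝ≥0∞) : Prop :=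
  ∃ ρ₁ : ℝ, 0 < ρ₁ ∧ ∀ ρ : ℝ, 0 < ρ → ρ < ρ₁ → ∀ ε : ℝ, 0 < ε →
    ∀ᶠ N : ℕ in atTop,
      condensateNumber w N (sideLength ρ N) ≤
        condensateNumber v N (sideLength ρ N) + ENNReal.ofReal (ε * N)

/-- Dilute ground-state BEC for one potential (the common conclusion shape of `A` and `B`). [folklore] -/
def DiluteBEC (v : ℝ → ℝ≥0∞) : Prop :=
  ∃ ρ₀ : ℝ, 0 < ρ₀ ∧ ∀ ρ : ℝ, 0 < ρ → ρ < ρ₀ → HasGroundStateBEC v ρ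

/-- The hard sphere of radius `a`, spelled as in route `BECHardSphereReduction`:
`⊤` on `(-∞, a]`, `0` beyond. [cite: LSSY2005, Ch. 2, paragraph after (2.1)] -/
abbrev hardSphere (a : ℝ) : ℝ → ℝ≥0∞ := Set.indicator (Set.Iic a) (fun _ => (⊤ : ℝ≥0∞))

/-- "Bounded on `[0, ∞)`" (the half reached by smooth pointwise dominants). [folklore] -/
def IsBoundedProfile (v : ℝ → ℝ≥0∞) : Prop := ∃ M : ℝ≥0, ∀ r, 0 ≤ r → v r ≤ M

/-- "Rough" = unbounded on `[0, ∞)` (hard cores, hard sets, `r⁻ᵖ` cores): the residue that only a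
hard sphere dominates pointwise. [folklore] -/
def IsRoughProfile (v : ℝ → ℝ≥0∞) : Prop := ∀ M : ℝ≥0, ∃ r, 0 ≤ r ∧ (M : ℝ≥0∞) < v r

/-! ## Statements of the registered stubs -/

/-- **Stub 1 — DOMINATION ORDER REVERSAL** (the card's first lemma; Disproof open target (T1) WITH
slack; pointwise calibration, smooth dominant; crux-strength, HARDEST of the bounded half). If
`v ≤ w` on `[0, ∞)` with `w` in the smooth class, then `w ≼ v`: more repulsion, no more condensate,
up to `o(N)`, eventually, at every small density. Why plausible: at Bogoliubov level
`n₀ = N − Σ v_k²` with `∂v_k²/∂Δ_k = ε_kΔ_k/2E_k³ > 0` mode by mode and `Δ_k = nV̂_eff(k)`,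
`V̂_eff(0) = 8π𝔞`, `𝔞(v) < 𝔞(w)` strictly unless `v = w` a.e. (`scatteringLength_mono`); the
response kernel lives at the healing scale `|k| ≲ √(8πρ𝔞) ≪ 1/R` where `û ≈ û(0) > 0` for every
increment `u = w − v ≥ 0` of range `R`. Intended road (card): SIGN of the linear response
`−(d/ds) n₀(v + su)` as a ground-state cross-covariance (one form domain: `u` bounded), not a size
estimate. `v ≤ w` smooth forces `v` bounded and `E₀ < ⊤` (no hard-set junk); `v = w`, `v = 0`
trivial; the isotone direction and the unguarded/fixed-box forms are refuted (Disproof §4), this one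
is not (§8/§9). Size: open-problem (no comparison theorem for `λ_max(γ_Ψ₀)` in `v` is in print).
[cite: LSSY2005, Ch. 5 and App. C Lemma C.2] -/
def Sig.stub_dominationOrderReversal : Prop :=
  ∀ v w : ℝ → ℝ≥0∞, IsRepulsiveFiniteRange v → InSmoothClass w → (∀ r, 0 ≤ r → v r ≤ w r) →
    CondensateBelow w v

/-- **Stub 2 — SMOOTH DOMINANTS EXIST** (support, M): every admissible `v` bounded by `M` on `[0, ∞)`
with range `R₀` lies below a smooth-class `w`, e.g. `w(x) = (M+1)·ζ(‖x‖²)⁴` with `ζ ∈ C^∞`,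
`ζ ≡ 1` on `[0, R₀²]`, `ζ = 0` beyond `(R₀+1)²`: `D²(ζ⁴) = 4ζ³D²ζ + 12ζ²Dζ⊗Dζ` gives the edge
condition with `√(ζ⁴) = ζ²` (Disproof §8 on `ShieldExists`), `ContDiffBump` supplies `ζ`. [folklore] -/
def Sig.stub_smoothDominant : Prop :=
  ∀ v : ℝ → ℝ≥0∞, IsRepulsiveFiniteRange v → IsBoundedProfile v →
    ∃ w : ℝ → ℝ≥0∞, InSmoothClass w ∧ ∀ r, 0 ≤ r → v r ≤ w r

/-- **Stub 3 — HARD-CORE DOMINATION** ((T1) with slack, hard-sphere dominant; crux-strength): for a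
ROUGH admissible `v` below the hard sphere of radius `a` on `[0, ∞)` (i.e. `v = 0` beyond `a`),
`HS_a ≼ v`: imposing "no pair closer than `a`" on a dilute gas cannot raise the condensate by more
than `o(N)`. It is IMPLIED by the fixed-box exact form `BECHardSphereReduction.HardCoreDominates`
(stmt-11884, rank-2 crux of that route; `hardCoreDomination_of_hardCoreDominates` below), and is
weaker than it exactly where the disprover found fixed-box comparisons fragile (slack `εN`, `∀ᶠ N`).
Degenerate members: `v = HS_a` (equality); thin shells `⊤·1_{{b}}` (a.e. zero: `cn v = cn 0 = N`);
hard shells `⊤·1_{[b,a]}` (caged pairs cost `≈ 2π²/b²` per pair, absent from dilute near-minimisers: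
equality up to `o(N)`); `E₀ = ⊤` impossible below `HS_a` at low density (`finiteEnergyAtLowDensity`).
[cite: LSSY2005, Ch. 2 after (2.1) and Ch. 5] -/
def Sig.stub_hardCoreDomination : Prop :=
  ∀ a : ℝ, 0 < a → ∀ v : ℝ → ℝ≥0∞, IsRepulsiveFiniteRange v → IsRoughProfile v →
    (∀ r, 0 ≤ r → v r ≤ hardSphere a r) → CondensateBelow (hardSphere a) v

/-- **Stub 4 — A SMOOTH STAND-IN FOR THE HARD SPHERE** (the card's recalibration of the order, in its
weakest sufficient form; crux-strength, HARDEST stub of the line): for every radius `a > 0` SOME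
smooth-class `w` condenses no better than `HS_a`, up to `o(N)`, at every small density. Witness
recipe (card `ScatteringOrderReversal`): any smooth-class `w` with `𝔞(w) ≥ 2a`, e.g. a tall bump
`t·ζ(‖x‖²/4a²)⁴`, `t → ∞` (`𝔞 ↑ 2a·(range factor)`); leading-order depletion
`1 − cn/N → 1.5045√(ρ𝔞³)` (Lee–Huang–Yang; DMC-universal in `ρ𝔞³` for hard AND soft spheres,
GiorginiBoronatCasulleras1999) leaves the margin `(2^{3/2} − 1)·1.5045√(ρa³)N` against every
non-universal `O(ρ𝔞³ log)` correction once `ρ < ρ₁(a, w)`. By `Negative.ScalingReductions`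
(`condensateNumber_scalePotential_sideLength`, `smoothClass` dilation invariant) the case `a = 1`
implies all `a`. With `A` it yields `BECHardSphereReduction.HardSphereBEC` (stmt-11885;
`hardSphereBEC_of_standIn'`). Why it might fail: it compares two DIFFERENT shapes at LHY precision of
the condensate fraction — beyond every proved asymptotics; a proof by pure order/sign arguments would
need a smooth `w` that is "more repulsive than `HS_a`" in a sense finer than pointwise.
[cite: LSSY2005, Ch. 5; GiorginiBoronatCasulleras1999; BoccatoEtAl2019Acta, Thm 1.1] -/
def Sig.stub_hardSphereStandIn : Prop :=
  ∀ a : ℝ, 0 < a → ∃ w : ℝ → ℝ≥0∞, InSmoothClass w ∧ CondensateBelow w (hardSphere a)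

/-! ## Registered stubs (the ONLY `sorry`s of this file)

v1.1 (lead c8): the four registered obligations are stated in TREE VOCABULARY (the line's `InSmoothClass`,
`IsBoundedProfile`, `IsRoughProfile`, `CondensateBelow`, `hardSphere` unfolded), so that a worker's
`Theorems/…` file — which cannot import this `Cruxes/` module — proves the registered signature verbatim; each
is definitionally `Sig.stub_<name>` (`stub_<name>_iff_sig`), and the glue below consumes them through that
defeq. -/

/-- **Stub 1** (open-problem; hardest of the bounded half) — `Sig.stub_dominationOrderReversal` unfolded:
`v ≤ w` on `[0, ∞)` with `w` in the smooth class ⇒ `w ≼ v` (antitone comparison with slack `εN`, eventually in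
`N`, at every density below a threshold chosen AFTER the pair). -/
theorem stub_dominationOrderReversal :
    ∀ v w : ℝ → ℝ≥0∞, IsRepulsiveFiniteRange v →
      (IsRepulsiveFiniteRange w ∧ (∀ r, w r ≠ ⊤) ∧ ContDiff ℝ 2 (fun x : Space => (w ‖x‖).toReal) ∧
        ∃ Cₑ : ℝ, ∀ x : Space,
          ‖iteratedFDeriv ℝ 2 (fun x : Space => (w ‖x‖).toReal) x‖ ≤ Cₑ * Real.sqrt ((w ‖x‖).toReal)) →
      (∀ r, 0 ≤ r → v r ≤ w r) →
      ∃ ρ₁ : ℝ, 0 < ρ₁ ∧ ∀ ρ : ℝ, 0 < ρ → ρ < ρ₁ → ∀ ε : ℝ, 0 < ε →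
        ∀ᶠ N : ℕ in atTop,
          condensateNumber w N (sideLength ρ N) ≤
            condensateNumber v N (sideLength ρ N) + ENNReal.ofReal (ε * N) := by
  sorry

/-! **Stub 2 `stub_smoothDominant` is CLOSED** (v1.2): LANDED by the wave-1 worker as
`Theorems/BECConjugateDominationHardCoreExtensionSmoothDominant.lean` (p133478, ACCEPTED 43baca24a5f6) under this very
name and namespace, and IMPORTED above — `stub_smoothDominant` below refers to the landed theorem. -/

/-- **Stub 3** (open-problem; implied by stmt-11884 `BECHardSphereReduction.HardCoreDominates`, see
`hardCoreDomination_of_hardCoreDominates`) — `Sig.stub_hardCoreDomination` unfolded: for a ROUGH admissible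
`v` below the hard sphere of radius `a` on `[0, ∞)`, `HS_a ≼ v`. -/
theorem stub_hardCoreDomination :
    ∀ a : ℝ, 0 < a → ∀ v : ℝ → ℝ≥0∞, IsRepulsiveFiniteRange v →
      (∀ M : ℝ≥0, ∃ r, 0 ≤ r ∧ (M : ℝ≥0∞) < v r) →
      (∀ r, 0 ≤ r → v r ≤ Set.indicator (Set.Iic a) (fun _ => (⊤ : ℝ≥0∞)) r) →
      ∃ ρ₁ : ℝ, 0 < ρ₁ ∧ ∀ ρ : ℝ, 0 < ρ → ρ < ρ₁ → ∀ ε : ℝ, 0 < ε →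
        ∀ᶠ N : ℕ in atTop,
          condensateNumber (Set.indicator (Set.Iic a) (fun _ => (⊤ : ℝ≥0∞))) N (sideLength ρ N) ≤
            condensateNumber v N (sideLength ρ N) + ENNReal.ofReal (ε * N) := by
  sorry

/-- **Stub 4** (open-problem; HARDEST) — `Sig.stub_hardSphereStandIn` unfolded: for every radius `a > 0`
SOME smooth-class `w` satisfies `w ≼ HS_a`. With `A` it yields stmt-11885 (`hardSphereBEC_of_standIn'`). -/
theorem stub_hardSphereStandIn :
    ∀ a : ℝ, 0 < a → ∃ w : ℝ → ℝ≥0∞,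
      (IsRepulsiveFiniteRange w ∧ (∀ r, w r ≠ ⊤) ∧ ContDiff ℝ 2 (fun x : Space => (w ‖x‖).toReal) ∧
        ∃ Cₑ : ℝ, ∀ x : Space,
          ‖iteratedFDeriv ℝ 2 (fun x : Space => (w ‖x‖).toReal) x‖ ≤ Cₑ * Real.sqrt ((w ‖x‖).toReal)) ∧
      ∃ ρ₁ : ℝ, 0 < ρ₁ ∧ ∀ ρ : ℝ, 0 < ρ → ρ < ρ₁ → ∀ ε : ℝ, 0 < ε →
        ∀ᶠ N : ℕ in atTop,
          condensateNumber w N (sideLength ρ N) ≤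
            condensateNumber (Set.indicator (Set.Iic a) (fun _ => (⊤ : ℝ≥0∞))) N (sideLength ρ N) +
              ENNReal.ofReal (ε * N) := by
  sorry

/-! ### The registered statements ARE the line's `Sig.*` (definitional read-back) -/

/-- Stub 1 as registered is `Sig.stub_dominationOrderReversal` (by `Iff.rfl`). [folklore] -/
theorem stub_dominationOrderReversal_iff_sig :
    (∀ v w : ℝ → ℝ≥0∞, IsRepulsiveFiniteRange v →
      (IsRepulsiveFiniteRange w ∧ (∀ r, w r ≠ ⊤) ∧ ContDiff ℝ 2 (fun x : Space => (w ‖x‖).toReal) ∧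
        ∃ Cₑ : ℝ, ∀ x : Space,
          ‖iteratedFDeriv ℝ 2 (fun x : Space => (w ‖x‖).toReal) x‖ ≤ Cₑ * Real.sqrt ((w ‖x‖).toReal)) →
      (∀ r, 0 ≤ r → v r ≤ w r) →
      ∃ ρ₁ : ℝ, 0 < ρ₁ ∧ ∀ ρ : ℝ, 0 < ρ → ρ < ρ₁ → ∀ ε : ℝ, 0 < ε →
        ∀ᶠ N : ℕ in atTop,
          condensateNumber w N (sideLength ρ N) ≤
            condensateNumber v N (sideLength ρ N) + ENNReal.ofReal (ε * N)) ↔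
    Sig.stub_dominationOrderReversal :=
  Iff.rfl

/-- Stub 2 as registered is `Sig.stub_smoothDominant` (by `Iff.rfl`). [folklore] -/
theorem stub_smoothDominant_iff_sig :
    (∀ v : ℝ → ℝ≥0∞, IsRepulsiveFiniteRange v → (∃ M : ℝ≥0, ∀ r, 0 ≤ r → v r ≤ M) →
      ∃ w : ℝ → ℝ≥0∞,
        (IsRepulsiveFiniteRange w ∧ (∀ r, w r ≠ ⊤) ∧ ContDiff ℝ 2 (fun x : Space => (w ‖x‖).toReal) ∧
          ∃ Cₑ : ℝ, ∀ x : Space,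
            ‖iteratedFDeriv ℝ 2 (fun x : Space => (w ‖x‖).toReal) x‖ ≤ Cₑ * Real.sqrt ((w ‖x‖).toReal)) ∧
        ∀ r, 0 ≤ r → v r ≤ w r) ↔
    Sig.stub_smoothDominant :=
  Iff.rfl

/-- Stub 3 as registered is `Sig.stub_hardCoreDomination` (by `Iff.rfl`). [folklore] -/
theorem stub_hardCoreDomination_iff_sig :
    (∀ a : ℝ, 0 < a → ∀ v : ℝ → ℝ≥0∞, IsRepulsiveFiniteRange v →
      (∀ M : ℝ≥0, ∃ r, 0 ≤ r ∧ (M : ℝ≥0∞) < v r) →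
      (∀ r, 0 ≤ r → v r ≤ Set.indicator (Set.Iic a) (fun _ => (⊤ : ℝ≥0∞)) r) →
      ∃ ρ₁ : ℝ, 0 < ρ₁ ∧ ∀ ρ : ℝ, 0 < ρ → ρ < ρ₁ → ∀ ε : ℝ, 0 < ε →
        ∀ᶠ N : ℕ in atTop,
          condensateNumber (Set.indicator (Set.Iic a) (fun _ => (⊤ : ℝ≥0∞))) N (sideLength ρ N) ≤
            condensateNumber v N (sideLength ρ N) + ENNReal.ofReal (ε * N)) ↔
    Sig.stub_hardCoreDomination :=
  Iff.rfl

/-- Stub 4 as registered is `Sig.stub_hardSphereStandIn` (by `Iff.rfl`). [folklore] -/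
theorem stub_hardSphereStandIn_iff_sig :
    (∀ a : ℝ, 0 < a → ∃ w : ℝ → ℝ≥0∞,
      (IsRepulsiveFiniteRange w ∧ (∀ r, w r ≠ ⊤) ∧ ContDiff ℝ 2 (fun x : Space => (w ‖x‖).toReal) ∧
        ∃ Cₑ : ℝ, ∀ x : Space,
          ‖iteratedFDeriv ℝ 2 (fun x : Space => (w ‖x‖).toReal) x‖ ≤ Cₑ * Real.sqrt ((w ‖x‖).toReal)) ∧
      ∃ ρ₁ : ℝ, 0 < ρ₁ ∧ ∀ ρ : ℝ, 0 < ρ → ρ < ρ₁ → ∀ ε : ℝ, 0 < ε →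
        ∀ᶠ N : ℕ in atTop,
          condensateNumber w N (sideLength ρ N) ≤
            condensateNumber (Set.indicator (Set.Iic a) (fun _ => (⊤ : ℝ≥0∞))) N (sideLength ρ N) +
              ENNReal.ofReal (ε * N)) ↔
    Sig.stub_hardSphereStandIn :=
  Iff.rfl

/-! ## Composition NODE — LANDED (v1.4): `hardCoreExtension_of_dominationResidue` (registered stubs 1, 3, 4 ⊢ the
crux BY NAME, stub 2 discharged by the landed `stub_smoothDominant`) is the accepted
`Theorems/BECConjugateDominationHardCoreExtensionDominationResidue.lean` (p133712, ACCEPTED d2307c2802e2), imported above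
together with its glue (`diluteBEC_of_condensateBelow`, `condensateBelow_trans`, `le_hardSphere_of_range`,
`condensateBelow_of_boxDomination`) and the cross-route reductions `stub_hardCoreDomination_of_hardCoreDominates`
(stub 3 ⟸ stmt-11884), `hardSphereBEC_of_standIn` (stub 4 ∧ A ⟹ stmt-11885),
`hardCoreExtension_of_hardCoreDominates_standIn` (11884 ∧ stub 4 ⊢ crux), `hardCoreExtension_of_hardSphereReduction`
(11884 ∧ 11885 ⊢ crux, `A` idle). The in-file copies of the glue below are kept under their ORIGINAL names only where
they do not clash (the landed file owns `diluteBEC_of_condensateBelow`, `le_hardSphere_of_range`,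
`hardSphereBEC_of_standIn`; the skeleton's bundled-vocabulary versions are renamed `…'`). -/

/-! ## Glue (sorry-free) -/

/-- Unfolding of the order relation (pins the vocabulary definitionally). [folklore] -/
theorem condensateBelow_iff (w v : ℝ → ℝ≥0∞) :
    CondensateBelow w v ↔
      ∃ ρ₁ : ℝ, 0 < ρ₁ ∧ ∀ ρ : ℝ, 0 < ρ → ρ < ρ₁ → ∀ ε : ℝ, 0 < ε →
        ∀ᶠ N : ℕ in atTop,
          condensateNumber w N (sideLength ρ N) ≤
            condensateNumber v N (sideLength ρ N) + ENNReal.ofReal (ε * N) :=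
  Iff.rfl

/-- `≼` is reflexive. [folklore] -/
theorem CondensateBelow.refl (v : ℝ → ℝ≥0∞) : CondensateBelow v v :=
  ⟨1, one_pos, fun _ _ _ _ _ => Eventually.of_forall fun _ => le_self_add⟩

/-- `≼` is transitive (`ρ₁ = min`, `ε/2 + ε/2`). [folklore] -/
theorem CondensateBelow.trans {w u v : ℝ → ℝ≥0∞} (h₁ : CondensateBelow w u)
    (h₂ : CondensateBelow u v) : CondensateBelow w v := by
  obtain ⟨ρ₁, hρ₁, H₁⟩ := h₁
  obtain ⟨ρ₂, hρ₂, H₂⟩ := h₂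
  refine ⟨min ρ₁ ρ₂, lt_min hρ₁ hρ₂, fun ρ hρ hlt ε hε => ?_⟩
  have hε2 : 0 < ε / 2 := half_pos hε
  filter_upwards [H₁ ρ hρ (hlt.trans_le (min_le_left _ _)) (ε / 2) hε2,
    H₂ ρ hρ (hlt.trans_le (min_le_right _ _)) (ε / 2) hε2] with N hN₁ hN₂
  have hnn : 0 ≤ ε / 2 * (N : ℝ) := mul_nonneg hε2.le N.cast_nonneg
  calc condensateNumber w N (sideLength ρ N)
      ≤ condensateNumber u N (sideLength ρ N) + ENNReal.ofReal (ε / 2 * N) := hN₁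
    _ ≤ condensateNumber v N (sideLength ρ N) + ENNReal.ofReal (ε / 2 * N) +
          ENNReal.ofReal (ε / 2 * N) := add_le_add hN₂ le_rfl
    _ = condensateNumber v N (sideLength ρ N) + ENNReal.ofReal (ε * N) := by
        rw [add_assoc, ← ENNReal.ofReal_add hnn hnn,
          show ε / 2 * (N : ℝ) + ε / 2 * (N : ℝ) = ε * N by ring]

/-- **The one use of the antecedent.** If `w ≼ v` and `w` has dilute BEC (constants `ρ₀(w)`,
`c(w, ρ)`), then `v` has dilute BEC with `ρ₀' = min(ρ₀, ρ₁)` and `c' = c/2`: eventually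
`c N ≤ cn w ≤ cn v + (c/2) N`. An additive `o(N)` against ONE fixed `c(w, ρ) > 0` is harmless
(memo B2 of NOTES-ideator1: it is fatal only along families). [folklore] -/
theorem diluteBEC_of_condensateBelow' {w v : ℝ → ℝ≥0∞} (hwv : CondensateBelow w v)
    (hw : DiluteBEC w) : DiluteBEC v := by
  obtain ⟨ρ₁, hρ₁, hcmp⟩ := hwv
  obtain ⟨ρ₀, hρ₀, hbec⟩ := hw
  refine ⟨min ρ₀ ρ₁, lt_min hρ₀ hρ₁, fun ρ hρ hlt => ?_⟩
  obtain ⟨c, hc, hev⟩ := hbec ρ hρ (hlt.trans_le (min_le_left _ _))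
  have hc2 : 0 < c / 2 := half_pos hc
  refine ⟨c / 2, hc2, ?_⟩
  filter_upwards [hev, hcmp ρ hρ (hlt.trans_le (min_le_right _ _)) (c / 2) hc2] with N hN hN'
  have hnn : 0 ≤ c / 2 * (N : ℝ) := mul_nonneg hc2.le N.cast_nonneg
  have hsplit : ENNReal.ofReal (c * N) = ENNReal.ofReal (c / 2 * N) + ENNReal.ofReal (c / 2 * N) := by
    rw [← ENNReal.ofReal_add hnn hnn, show c / 2 * (N : ℝ) + c / 2 * (N : ℝ) = c * N by ring]
  have h := hN.trans hN'
  rw [hsplit] at h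
  exact (ENNReal.add_le_add_iff_right ENNReal.ofReal_ne_top).1 h

/-- The two halves of the class: bounded on `[0, ∞)` or rough (classical). [folklore] -/
theorem bounded_or_rough (v : ℝ → ℝ≥0∞) : IsBoundedProfile v ∨ IsRoughProfile v := by
  by_cases h : IsBoundedProfile v
  · exact Or.inl h
  · refine Or.inr fun M => ?_
    by_contra hM
    push Not at hM
    exact h ⟨M, fun r hr => hM r hr⟩

/-- Every admissible `v` vanishing beyond `R` lies below the hard sphere of any radius `a > R`
on `[0, ∞)`. [cite: LSSY2005, Ch. 2 after (2.1)] -/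
theorem le_hardSphere_of_range' {v : ℝ → ℝ≥0∞} {R a : ℝ} (hvR : ∀ r, R < r → v r = 0)
    (hRa : R < a) : ∀ r, 0 ≤ r → v r ≤ hardSphere a r := by
  intro r _
  by_cases h : r ≤ a
  · simp [hardSphere, Set.indicator_of_mem (Set.mem_Iic.2 h)]
  · rw [hvR r (hRa.trans (lt_of_not_ge h))]
    exact zero_le

/-- The antecedent `A` of the crux (verbatim, curried) on the bundled smooth class. [folklore] -/
theorem diluteBEC_of_antecedent
    (hA : ∀ v : ℝ → ℝ≥0∞, IsRepulsiveFiniteRange v → (∀ r, v r ≠ ⊤) →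
      ContDiff ℝ 2 (fun x : Space => (v ‖x‖).toReal) →
      (∃ Cₑ : ℝ, ∀ x : Space, ‖iteratedFDeriv ℝ 2 (fun x : Space => (v ‖x‖).toReal) x‖ ≤
          Cₑ * Real.sqrt ((v ‖x‖).toReal)) →
      ∃ ρ₀ : ℝ, 0 < ρ₀ ∧ ∀ ρ : ℝ, 0 < ρ → ρ < ρ₀ → HasGroundStateBEC v ρ)
    {w : ℝ → ℝ≥0∞} (hw : InSmoothClass w) : DiluteBEC w :=
  hA w hw.1 hw.2.1 hw.2.2.1 hw.2.2.2

/-! ## The halves (sorry-free given the stubs as hypotheses) -/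

/-- **Bounded half** (the card's `bounded_half_of_domination`, re-proved; triage r1-2 `T.lean`):
stubs 1–2 and `A` give dilute BEC for every admissible `v` bounded on `[0, ∞)` — `A` used ONCE, at
the dominant. [folklore] -/
theorem boundedHalf_of (h₁ : Sig.stub_dominationOrderReversal) (h₂ : Sig.stub_smoothDominant)
    (hA : ∀ w, InSmoothClass w → DiluteBEC w) {v : ℝ → ℝ≥0∞} (hv : IsRepulsiveFiniteRange v)
    (hb : IsBoundedProfile v) : DiluteBEC v := by
  obtain ⟨w, hw, hvw⟩ := h₂ v hv hb
  exact diluteBEC_of_condensateBelow' (h₁ v w hv hw hvw) (hA w hw)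

/-- **Rough half**: stubs 3–4 and `A` give dilute BEC for every rough admissible `v`
(`v ≤ HS_a` for `a` = range + 1; `w ≼ HS_a ≼ v`; `A` once, at `w`). [folklore] -/
theorem roughHalf_of (h₃ : Sig.stub_hardCoreDomination) (h₄ : Sig.stub_hardSphereStandIn)
    (hA : ∀ w, InSmoothClass w → DiluteBEC w) {v : ℝ → ℝ≥0∞} (hv : IsRepulsiveFiniteRange v)
    (hr : IsRoughProfile v) : DiluteBEC v := by
  obtain ⟨R, hR, hvR⟩ := hv.exists_pos_range
  have ha : 0 < R + 1 := by linarith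
  obtain ⟨w, hw, hwHS⟩ := h₄ (R + 1) ha
  have hHSv : CondensateBelow (hardSphere (R + 1)) v :=
    h₃ (R + 1) ha v hv hr (le_hardSphere_of_range' hvR (by linarith))
  exact diluteBEC_of_condensateBelow' (hwHS.trans hHSv) (hA w hw)

/-! ## Composition: the registered stubs give the crux BY NAME -/

/-- **The pure glue, hypotheses explicit** (stubs 1–4 as hypotheses, the antecedent bundled):
split `bounded_or_rough v`; bounded → `boundedHalf_of`, rough → `roughHalf_of`. Stated in the
UNFOLDED form of the crux so that `HardCoreExtension_of` below is the unique theorem of this file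
concluding the crux decl by name. [folklore] -/
theorem hardCoreExtension_of_parts (h₁ : Sig.stub_dominationOrderReversal)
    (h₂ : Sig.stub_smoothDominant) (h₃ : Sig.stub_hardCoreDomination)
    (h₄ : Sig.stub_hardSphereStandIn) (hA : ∀ w, InSmoothClass w → DiluteBEC w)
    (v : ℝ → ℝ≥0∞) (hv : IsRepulsiveFiniteRange v) : DiluteBEC v := by
  rcases bounded_or_rough v with hb | hr
  · exact boundedHalf_of h₁ h₂ hA hv hb
  · exact roughHalf_of h₃ h₄ hA hv hr

/-- **`HardCoreExtension` from the four REGISTERED stubs (by name)** — the skeleton: given the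
antecedent `A` (used through `diluteBEC_of_antecedent`, i.e. ONCE per target potential, at one
smooth comparison potential) and an admissible `v`, `hardCoreExtension_of_parts` with
`stub_dominationOrderReversal`, `stub_smoothDominant`, `stub_hardCoreDomination`,
`stub_hardSphereStandIn`. No `sorry` of its own; its only open leaves are the four stubs. [folklore] -/
theorem HardCoreExtension_of : BECConjugateDomination.HardCoreExtension :=
  hardCoreExtension_of_dominationResidue stub_dominationOrderReversal stub_hardCoreDomination
    stub_hardSphereStandIn

/-- The same through the in-file glue `hardCoreExtension_of_parts` (all four stubs, stub 2 = the landed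
theorem): a second, definitionally equal reading of the skeleton. -/
example : BECConjugateDomination.HardCoreExtension := fun hA v hv =>
  hardCoreExtension_of_parts stub_dominationOrderReversal stub_smoothDominant
    stub_hardCoreDomination stub_hardSphereStandIn (fun _ hw => diluteBEC_of_antecedent hA hw) v hv

/-! ## Cross-links with route `BECHardSphereReduction` (sorry-free) -/

/-- **Stub 3 is implied by the rank-2 crux `HardCoreDominates` of route `BECHardSphereReduction`**
(stmt-11884, fixed-box exact comparison under the guard `N a³ ≤ η₀ L³`): along `L_N = (N/ρ)^{1/3}`
the guard reads `ρ a³ ≤ η₀`, so `ρ₁ := η₀/a³` and the slack is not even used. [folklore] -/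
theorem hardCoreDomination_of_hardCoreDominates (h : BECHardSphereReduction.HardCoreDominates) :
    Sig.stub_hardCoreDomination := by
  intro a ha v hv _ hle
  have hva : ∀ r : ℝ, a < r → v r = 0 := fun r hr => by
    have h0 := hle r (ha.le.trans hr.le)
    have : hardSphere a r = 0 := by
      simp [hardSphere, Set.indicator_of_notMem (show r ∉ Set.Iic a from fun hm => (not_le.2 hr) hm)]
    rw [this] at h0
    exact le_antisymm h0 zero_le
  obtain ⟨η₀, hη₀, hdom⟩ := h v a hv.1 ha hva
  have ha3 : 0 < a ^ 3 := pow_pos ha 3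
  refine ⟨η₀ / a ^ 3, div_pos hη₀ ha3, fun ρ hρ hlt ε _ => Eventually.of_forall fun N => ?_⟩
  have hρa : ρ * a ^ 3 ≤ η₀ := ((lt_div_iff₀ ha3).1 hlt).le
  refine (hdom N (sideLength ρ N) ?_).trans le_self_add
  rw [sideLength_pow_three hρ N]
  have hNρ : 0 ≤ (N : ℝ) / ρ := div_nonneg N.cast_nonneg hρ.le
  calc (N : ℝ) * a ^ 3 = (N : ℝ) / ρ * (ρ * a ^ 3) := by field_simp
    _ ≤ (N : ℝ) / ρ * η₀ := mul_le_mul_of_nonneg_left hρa hNρ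
    _ = η₀ * ((N : ℝ) / ρ) := by ring

/-- **Stub 4 with `A` gives hard-sphere BEC** (`BECHardSphereReduction.HardSphereBEC`, stmt-11885):
the whole `A`-content of the rough half sits in the stand-in. [folklore] -/
theorem hardSphereBEC_of_standIn' (h₄ : Sig.stub_hardSphereStandIn)
    (hA : ∀ w, InSmoothClass w → DiluteBEC w) : BECHardSphereReduction.HardSphereBEC := by
  intro a ha
  obtain ⟨w, hw, hwHS⟩ := h₄ a ha
  exact diluteBEC_of_condensateBelow' hwHS (hA w hw)

/-- **Conversely the rough half needs hard-sphere BEC only**: stub 3 and `HardSphereBEC`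
(stmt-11885, however obtained) give dilute BEC for every rough admissible `v`, with no use of `A`.
So the rough half of this line = (stub 3) + (hard-sphere BEC from `A` via stub 4, or outright). [folklore] -/
theorem roughHalf_of_hardSphereBEC (h₃ : Sig.stub_hardCoreDomination)
    (hHS : BECHardSphereReduction.HardSphereBEC) {v : ℝ → ℝ≥0∞} (hv : IsRepulsiveFiniteRange v)
    (hr : IsRoughProfile v) : DiluteBEC v := by
  obtain ⟨R, hR, hvR⟩ := hv.exists_pos_range
  have ha : 0 < R + 1 := by linarith
  exact diluteBEC_of_condensateBelow'
    (h₃ (R + 1) ha v hv hr (le_hardSphere_of_range' hvR (by linarith))) (hHS (R + 1) ha)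

/-! ## Sanity: no vacuity in the classes quantified over -/

/-- The free gas is in the smooth class (edge condition with `Cₑ = 0`), so the `∃ w` of stubs 2 and 4
ranges over a nonempty class containing potentials with BEC (`hasGroundStateBEC_zero`). [folklore] -/
theorem inSmoothClass_zero : InSmoothClass 0 :=
  ⟨⟨measurable_const, 0, fun _ _ => rfl⟩, fun _ => ENNReal.zero_ne_top,
    Theorems.HardCoreExtension.Negative.contDiff_profile_zero,
    Theorems.HardCoreExtension.Negative.edgeCondition_zero⟩

/-- The hard sphere is admissible and ROUGH (so stub 3 is not vacuous and the rough half is the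
hard-core half). [folklore] -/
theorem hardSphere_admissible_rough {a : ℝ} (ha : 0 < a) :
    IsRepulsiveFiniteRange (hardSphere a) ∧ IsRoughProfile (hardSphere a) := by
  refine ⟨⟨(measurable_const.indicator measurableSet_Iic), a, fun r hr => ?_⟩, fun M => ⟨0, le_rfl, ?_⟩⟩
  · simp [hardSphere, Set.indicator_of_notMem (show r ∉ Set.Iic a from fun hm => (not_le.2 hr) hm)]
  · simp [hardSphere, Set.indicator_of_mem (Set.mem_Iic.2 ha.le)]

/-- A bounded profile is not rough and vice versa (the case split is a partition). [folklore] -/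
theorem not_rough_of_bounded {v : ℝ → ℝ≥0∞} (hb : IsBoundedProfile v) : ¬ IsRoughProfile v := by
  rintro hr
  obtain ⟨M, hM⟩ := hb
  obtain ⟨r, hr0, hlt⟩ := hr M
  exact (not_le.2 hlt) (hM r hr0)

end Summit.AtomisticToContinuum.BoseEinsteinCondensation.Cruxes.HardCoreExtension.DominationOrderReversal

end
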